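import Summits.PneNP.PneNP.Theorems.ConvexRankGatesCliqueExtLowerBoundGRankPartial
import Mathlib

/-!
# Wide GRANK gates with a low-rank moving part are sandwichable
(second partial result towards the stub `stub_grankSandwichable` of the line
`width-threshold-certificate-sparsity`, crux `ConvexRankGates.CliqueExtLowerBound`, stmt-PneNP-10682)

`…GRankPartial.grank_fewLines_sandwichable` settled the wide GRANK gates whose moving part
`∑ᵢ Xᵢ Kᵢ` is confined to `≤ L` lines (term rank `≤ L`), `L = ⌊m^{1/16}⌋₊ (log₂ ⌊m^{1/16}⌋₊ + 1)`.
Here the hypothesis is relaxed from TERM rank to GENERIC rank, in the gate's own vocabulary: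

* `grank_lowRankMoving_sandwichable` — GRANK gates `[θ ≤ rank_{Frac F[X]} (K₀ + ∑_{vᵢ=1} Xᵢ Kᵢ)]`
  of ANY dimension `d`, ANY threshold `θ`, ANY constant part `K₀`, whose moving part alone (all
  wires on) has generic rank `rank_{Frac F[X]} (∑ᵢ Xᵢ Kᵢ) ≤ L` — i.e. `symbolicMatrix 0 K ⊤` has
  rank `≤ L`: "does a generic perturbation of rank `≤ L` of the fixed matrix `K₀` reach rank `θ`" —
  are sandwichable on the referee pair (conclusion of the stub, for `(r-1)`-DNF children below CNF
  children). Since generic rank `≤` term rank this contains the few-lines class.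

Proof. `totalDegree_minor_le_of_movingRank_le`: write a `θ × θ` minor of the generic matrix as
`det (A' + N')` (`A'` constants from `K₀`, `N'` the corresponding minor-block of the moving part)
and expand multilinearly in the rows (`MultilinearMap.map_add_univ`): the term taking the rows
outside `s` from `N'` has total degree `≤ #sᶜ` (Leibniz, `totalDegree_det_le_lines`), and VANISHES
once `#sᶜ > L`, because over `Frac F[X]` those rows lie in the row space of a matrix of rank `≤ L`
(`det_eq_zero_of_rows_eq_of_rank_lt`, `Matrix.rank_submatrix_le`). So every `θ`-minor has total
degree `≤ L`, an accepted pattern keeps a monomial of such a minor switched on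
(`le_rank_symbolicMatrix_iff`), hence has an accepted sub-pattern of `≤ L` wires
(`grank_local_movingRank`), and `sandwichable_of_shortPatterns` applies with no exceptional
positives.

References: J. Edmonds (1967), §5 Thm. 1 [Edmonds1967]; S. Jukna, *Boolean Function Complexity*
(2012), Lemma 9.15 [Jukna2012].
-/

set_option linter.dupNamespace false

open Literature.Computability.Complexity Filter Finset MvPolynomial

namespace Summit.PneNP.PneNP.Theorems.CliqueExtLowerBound.WidthThreshold.GRankPartial2

open Summit.PneNP.PneNP.Theorems.Capture.Negative (card_support_le_totalDegree
  totalDegree_symbolicPolyMatrix_apply_le)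
open Summit.PneNP.PneNP.Theorems.CliqueExtLowerBound.WidthThreshold.GRankPartial
  (totalDegree_det_le_lines)
open Summit.PneNP.PneNP.Theorems.CliqueExtLowerBound.WidthThreshold.SandwichEffectiveWidth
  (sandwichable_of_shortPatterns)

/-! ## §1 Linear algebra: rows inside a low-rank row space kill the determinant -/

-- adapted from `det_eq_zero_of_rows_eq_of_rank_lt` in
-- `Summits/QuantumFields/QCD/Theorems/PauliWegnerSeaPauliBandLimitDetRank.lean`
/-- If the rows of `N` indexed by `S` are the corresponding rows of `B` and `S` has more than
`rank B` elements, then `det N = 0` (those rows are linearly dependent). [folklore] -/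
theorem det_eq_zero_of_rows_eq_of_rank_lt {L : Type*} [Field L] {ι : Type*} [Fintype ι]
    [DecidableEq ι] (B N : Matrix ι ι L) (S : Finset ι) (hS : ∀ i ∈ S, N i = B i)
    (hr : B.rank < #S) : N.det = 0 := by
  by_contra h
  have hU : IsUnit N := (Matrix.isUnit_iff_isUnit_det N).2 (isUnit_iff_ne_zero.2 h)
  have hli : LinearIndependent L N.row := Matrix.linearIndependent_rows_iff_isUnit.2 hU
  have hliS : LinearIndependent L (fun i : S => B (i : ι)) := by
    have h' := hli.comp (Subtype.val : S → ι) Subtype.val_injective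
    convert h' using 1
    funext i
    exact (hS i i.2).symm
  have h1 : Fintype.card S ≤ (Set.range fun i : S => B (i : ι)).finrank L :=
    linearIndependent_iff_card_le_finrank_span.1 hliS
  have h2 : (Set.range fun i : S => B (i : ι)).finrank L ≤ (Set.range B.row).finrank L :=
    Set.finrank_mono (Set.range_comp_subset_range (Subtype.val : S → ι) B)
  have h3 : (Set.range B.row).finrank L = B.rank := (B.rank_eq_finrank_span_row).symm
  rw [Fintype.card_coe] at h1
  omega

/-! ## §2 Minors of a pencil with a low-rank moving part have low degree -/

section MovingRank

variable {F : Type*} [Field F] {n d : ℕ}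

/-- With every wire on, no variable is killed. [folklore] -/
theorem killVars_true (p : MvPolynomial (Fin n) F) : killVars (fun _ : Fin n => true) p = p := by
  simp [killVars]

/-- The generic moving part `∑ᵢ Xᵢ Kᵢ` over `Frac F[X]` (the gate's `symbolicMatrix 0 K ⊤`) is the
image of the polynomial moving part `symbolicPolyMatrix 0 K`. [folklore] -/
theorem symbolicMatrix_zero_true (K : Fin n → Matrix (Fin d) (Fin d) F) :
    symbolicMatrix (0 : Matrix (Fin d) (Fin d) F) K (fun _ => true) =
      (symbolicPolyMatrix 0 K).map
        (algebraMap (MvPolynomial (Fin n) F) (FractionRing (MvPolynomial (Fin n) F))) := by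
  rw [symbolicMatrix_eq_map]
  congr 1
  ext a b
  rw [Matrix.map_apply, killVars_true]

/-- The generic symbolic matrix splits as constant part plus moving part. [folklore] -/
theorem symbolicPolyMatrix_eq_add (K₀ : Matrix (Fin d) (Fin d) F)
    (K : Fin n → Matrix (Fin d) (Fin d) F) :
    symbolicPolyMatrix K₀ K =
      K₀.map (C : F →+* MvPolynomial (Fin n) F) + symbolicPolyMatrix 0 K := by
  simp [symbolicPolyMatrix]

/-- **Degree of the minors of a pencil with a low-rank moving part.** If the moving part
`∑ᵢ Xᵢ Kᵢ` has generic rank `≤ w`, then every `θ × θ` minor of `K₀ + ∑ᵢ Xᵢ Kᵢ` (ANY `K₀`, `θ`,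
`d`) has total degree `≤ w`: expand `det (A' + N')` multilinearly in the rows; the term taking the
rows outside `s` from the moving block `N'` has degree `≤ #sᶜ` (Leibniz) and vanishes when
`#sᶜ > w` (those rows lie in a row space of dimension `≤ w` over `Frac F[X]`). [folklore] -/
theorem totalDegree_minor_le_of_movingRank_le (K₀ : Matrix (Fin d) (Fin d) F)
    (K : Fin n → Matrix (Fin d) (Fin d) F) {w : ℕ}
    (hw : ((symbolicPolyMatrix 0 K).map (algebraMap (MvPolynomial (Fin n) F)
      (FractionRing (MvPolynomial (Fin n) F)))).rank ≤ w)
    {θ : ℕ} (r c : Fin θ → Fin d) :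
    (((symbolicPolyMatrix K₀ K).submatrix r c).det).totalDegree ≤ w := by
  classical
  set A' : Matrix (Fin θ) (Fin θ) (MvPolynomial (Fin n) F) :=
    (K₀.map (C : F →+* MvPolynomial (Fin n) F)).submatrix r c with hA'
  set N' : Matrix (Fin θ) (Fin θ) (MvPolynomial (Fin n) F) :=
    (symbolicPolyMatrix 0 K).submatrix r c with hN'
  have hsplit : (symbolicPolyMatrix K₀ K).submatrix r c = A' + N' := by
    rw [symbolicPolyMatrix_eq_add, Matrix.submatrix_add]
    rfl
  have hexp : (A' + N').det = ∑ s : Finset (Fin θ), Matrix.det (s.piecewise A' N') := by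
    have h := MultilinearMap.map_add_univ
      (Matrix.detRowAlternating :
        (Fin θ → MvPolynomial (Fin n) F) [⋀^Fin θ]→ₗ[MvPolynomial (Fin n) F]
          MvPolynomial (Fin n) F).toMultilinearMap A' N'
    simp only [AlternatingMap.coe_multilinearMap] at h
    exact h
  have hA'deg : ∀ a b, (A' a b).totalDegree = 0 := fun a b => by
    simp only [hA', Matrix.submatrix_apply, Matrix.map_apply]
    exact totalDegree_C _
  rw [hsplit, hexp]
  refine (totalDegree_finsetSum _ _).trans (Finset.sup_le fun s _ => ?_)
  by_cases hj : #(univ.filter fun a : Fin θ => a ∉ s) ≤ w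
  · -- few moving rows: Leibniz bound
    refine (totalDegree_det_le_lines (s.piecewise A' N') (fun a => a ∉ s) (fun _ => False)
      (fun a b => ?_) (fun a b ha _ => ?_)).trans ?_
    · by_cases ha : a ∈ s
      · rw [Finset.piecewise_eq_of_mem _ _ _ ha, hA'deg]
        exact Nat.zero_le _
      · rw [Finset.piecewise_eq_of_notMem _ _ _ ha]
        exact totalDegree_symbolicPolyMatrix_apply_le 0 K (r a) (c b)
    · rw [not_not] at ha
      rw [Finset.piecewise_eq_of_mem _ _ _ ha, hA'deg]
    · simpa using hj
  · -- many moving rows: the term vanishes over the fraction field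
    push Not at hj
    have h0 : Matrix.det (s.piecewise A' N') = 0 := by
      apply IsFractionRing.injective (MvPolynomial (Fin n) F) (FractionRing (MvPolynomial (Fin n) F))
      rw [map_zero, RingHom.map_det, RingHom.mapMatrix_apply]
      refine det_eq_zero_of_rows_eq_of_rank_lt
        (((symbolicPolyMatrix 0 K).map (algebraMap (MvPolynomial (Fin n) F)
          (FractionRing (MvPolynomial (Fin n) F)))).submatrix r c)
        _ (univ.filter fun a : Fin θ => a ∉ s) (fun a ha => ?_)
        (lt_of_le_of_lt ((Matrix.rank_submatrix_le _ r c).trans hw) hj)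
      rw [Finset.mem_filter] at ha
      funext b
      simp only [Matrix.map_apply, Matrix.submatrix_apply]
      rw [Finset.piecewise_eq_of_notMem _ _ _ ha.2]
      rfl
    rw [h0, totalDegree_zero]
    exact Nat.zero_le _

/-- **GRANK locality by the rank of the moving part (matrix form).** If the moving part
`∑ᵢ Xᵢ Kᵢ` has generic rank `≤ w` and the generic rank of `K₀ + ∑_{vᵢ=1} Xᵢ Kᵢ` is at least `θ`
(ANY `d`, `θ`, `K₀`), then already a sub-selection `t ⊆ {i | vᵢ = 1}` of at most `w` wires
achieves rank `≥ θ`: a `θ`-minor with a monomial switched on in `v` (`le_rank_symbolicMatrix_iff`)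
has total degree `≤ w` (`totalDegree_minor_le_of_movingRank_le`); switch on exactly the variables
of that monomial. [folklore] -/
theorem grank_local_movingRank (K₀ : Matrix (Fin d) (Fin d) F)
    (K : Fin n → Matrix (Fin d) (Fin d) F) {w : ℕ}
    (hw : (symbolicMatrix (0 : Matrix (Fin d) (Fin d) F) K (fun _ => true)).rank ≤ w) (θ : ℕ)
    (v : Fin n → Bool) (h : θ ≤ (symbolicMatrix K₀ K v).rank) :
    ∃ t : Finset (Fin n), #t ≤ w ∧ (∀ i ∈ t, v i = true) ∧
      θ ≤ (symbolicMatrix K₀ K (fun i => decide (i ∈ t))).rank := by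
  rw [symbolicMatrix_zero_true] at hw
  rw [le_rank_symbolicMatrix_iff] at h
  obtain ⟨r, c, m, hm, hv⟩ := h
  refine ⟨m.support, (card_support_le_totalDegree hm).trans
    (totalDegree_minor_le_of_movingRank_le K₀ K hw r c), hv, ?_⟩
  rw [le_rank_symbolicMatrix_iff]
  exact ⟨r, c, m, hm, fun i hi => by simpa using hi⟩

end MovingRank

/-! ## §3 Wide GRANK gates with a low-rank moving part are sandwichable -/

open Classical in
/-- **Wide GRANK gates whose moving part has low generic rank are sandwichable.** For every
`c` there are `r₀, s₀` such that for `r ≥ r₀`, `s ≥ s₀` and all large `m`: if `φ` accepts `v` iff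
the generic rank of `K₀ + ∑_{vᵢ = 1} Xᵢ Kᵢ` is at least `θ` — matrices of ANY dimension `d` over any
field, ANY threshold `θ`, ANY constant part `K₀` — and the moving part alone has generic rank
`rank_{Frac F[X]} (∑ᵢ Xᵢ Kᵢ) ≤ ⌊m^{1/16}⌋₊ (log₂ ⌊m^{1/16}⌋₊ + 1)` (the gate's `symbolicMatrix 0 K ⊤`),
then `φ` fed with `(r-1)`-DNFs below CNFs satisfies the conclusion of `stub_grankSandwichable`:
by `grank_local_movingRank` every accepted pattern has an accepted sub-pattern of `≤ L` wires, so
`sandwichable_of_shortPatterns` applies with no exceptional positives. Contains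
`grank_fewLines_sandwichable` (generic rank `≤` term rank); incomparable with
`grank_smallThreshold_sandwichable`. [folklore] -/
theorem grank_lowRankMoving_sandwichable : ∀ c : ℕ, ∃ r₀ s₀ : ℕ, 2 ≤ r₀ ∧ 2 ≤ s₀ ∧
    ∀ r s : ℕ, r₀ ≤ r → s₀ ≤ s →
    ∀ᶠ m : ℕ in atTop, ∀ (φ : GateFn) (F : Type) [Field F] (d θ : ℕ)
      (K₀ : Matrix (Fin d) (Fin d) F) (K : Fin φ.1 → Matrix (Fin d) (Fin d) F),
      (∀ v : Fin φ.1 → Bool, φ.2 v = true ↔ θ ≤ (symbolicMatrix K₀ K v).rank) →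
      (symbolicMatrix (0 : Matrix (Fin d) (Fin d) F) K (fun _ => true)).rank ≤
        ⌊(m : ℝ) ^ (1 / 16 : ℝ)⌋₊ * (Nat.log 2 ⌊(m : ℝ) ^ (1 / 16 : ℝ)⌋₊ + 1) →
      ∀ (D C : Fin φ.1 → Finset (Finset ((⊤ : SimpleGraph (Fin m)).edgeSet))),
        (∀ j, ∀ R ∈ D j, #R ≤ r - 1) → (∀ j x, EvalDNF (D j) x → EvalCNF (C j) x) →
        ∃ dnf cnf : Finset (Finset ((⊤ : SimpleGraph (Fin m)).edgeSet)),
          (∀ R ∈ dnf, #R ≤ r - 1) ∧ (∀ S ∈ cnf, #S ≤ s - 1) ∧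
          (∀ x, EvalDNF dnf x → EvalCNF cnf x) ∧
          (#((posGraphs m ⌈(m : ℝ) ^ (1 / 4 : ℝ)⌉₊).filter
              (fun x => φ.2 (fun j => decide (EvalDNF (D j) x)) = true ∧ ¬ EvalDNF dnf x)) : ℝ)
            ≤ (1 / (8 * (m : ℝ) ^ (c + 1))) * #(posGraphs m ⌈(m : ℝ) ^ (1 / 4 : ℝ)⌉₊) ∧
          (#((((powersetCard (Fintype.card ((⊤ : SimpleGraph (Fin m)).edgeSet) /
              ⌊(m : ℝ) ^ (1 / 8 : ℝ)⌋₊) (univ : Finset ((⊤ : SimpleGraph (Fin m)).edgeSet))).image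
              (fun M => fun e => decide (e ∉ M)))).filter
              (fun x => EvalCNF cnf x ∧ φ.2 (fun j => decide (EvalCNF (C j) x)) = false)) : ℝ)
            ≤ (1 / (8 * (m : ℝ) ^ (c + 1))) *
              #(((powersetCard (Fintype.card ((⊤ : SimpleGraph (Fin m)).edgeSet) /
                ⌊(m : ℝ) ^ (1 / 8 : ℝ)⌋₊) (univ : Finset ((⊤ : SimpleGraph (Fin m)).edgeSet))).image
                (fun M => fun e => decide (e ∉ M)))) := by
  intro c
  obtain ⟨r₀, s₀, hr₀, hs₀, H⟩ := sandwichable_of_shortPatterns c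
  refine ⟨r₀, s₀, hr₀, hs₀, fun r s hr hs => ?_⟩
  filter_upwards [H r s hr hs] with m hm
  intro φ F _ d θ K₀ K hφ hw D C hDw hDC
  have hG : IsGRankGate d φ := ⟨F, inferInstance, d, θ, le_rfl, K₀, K, hφ⟩
  refine hm φ hG.monotone D C hDw hDC fun E hE hbad => ?_
  -- no exceptional positives: every accepted pattern has an accepted sub-pattern of `≤ L` wires
  suffices hE0 : E = ∅ by rw [hE0, Finset.card_empty, Nat.zero_mul]; exact Nat.zero_le _
  refine Finset.eq_empty_of_forall_notMem fun x hx => ?_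
  obtain ⟨hacc, hno⟩ := hbad x hx
  obtain ⟨t, ht, hton, htacc⟩ := grank_local_movingRank K₀ K hw θ _ ((hφ _).1 hacc)
  have h1 := hno t ht (fun i hi => of_decide_eq_true (hton i hi))
  rw [(hφ _).2 htacc] at h1
  exact Bool.noConfusion h1

end Summit.PneNP.PneNP.Theorems.CliqueExtLowerBound.WidthThreshold.GRankPartial2
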